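import Summits.CriticalPhenomena.PercolationContinuityZ3.Theorems.PercNearOneGluingNoHeavyLowerTailMajorityGluingTypeTableScaledStarRoot
import HarnessLib

/-!
# Template S in the kernel: the STAR cuts — exponent brackets, the certified STAR-B table, the row theorems
(lane prim-rate, constants-miner 1, gen 30; KERNEL-WINDOW.md §1–§2; RIGOROUS-CERTIFICATION.md §1)

Support file for the closed crux `NoHeavyLowerTail` (stmt-CriticalPhenomena-4575), majority-gluing line; continuation of
`…TypeTableScaledStarRoot`.  `cb_brackets` (rational brackets of `β = 1/(2c₄−1)`, `c₄β`, `(4−c₄)β`, `e_B = 3β`, `1/c₄` from a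
13-digit bracket of `√(11/3)`), `zeta_bounds` (`ZL ≤ 2^{e_B/32} ≤ ZU`), `cb_factors` / **`CB_le_CBU240`** (the STAR-B constants are
below the table `CBU240`: four `rpow_le_cert` factors with continued-fraction exponent brackets), and the row theorems
**`star_valid`, `starB_valid`**: every `.star` / `.starB` row accepted by `SRow.ok` holds for the (restricted) scaled law of the case.
No percolation, no sorries.  [cite: VandenbergHaggstromKahn2005, Thm. 1.3 (p. 6)]
-/

namespace Summit.CriticalPhenomena.PercolationContinuityZ3.Theorems

namespace HubOnly
namespace TypeTable

open DType

noncomputable section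

variable {K : ℕ} {M : ℝ} {x : DType → ℝ} {cs : SCase}

/-! ### Exponent brackets and the certified STAR-B constants -/

/-- `√(11/3) ∈ (1.9148542155126, 1.9148542155127)` (one more digit than `RpowCert.sqrt_11_3_bounds`). -/
theorem sqrt_11_3_bounds13 : (19148542155126 : ℝ) / 10 ^ 13 < Real.sqrt (11 / 3) ∧
    Real.sqrt (11 / 3) < 19148542155127 / 10 ^ 13 := by
  constructor
  · rw [Real.lt_sqrt (by norm_num)]; norm_num
  · rw [Real.sqrt_lt' (by norm_num)]; norm_num

/-- Rational brackets of the STAR-B exponents: `β = 1/(2c₄−1) ≤ 505/1977`, `c₄β ≤ 1241/1977`, `7.5·(4−c₄)β ≥ 6667/2256`,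
`3β ≥ 2161/2820`, `EBL ≤ 3β ≤ EBU`, `207/8644 ≤ 3β/32 ≤ 178/7433`, and `1/c₄ ≤ 1609/3954`. -/
theorem cb_brackets :
    let c := (3 + Real.sqrt (11 / 3)) / 2
    (2 * c - 1)⁻¹ ≤ (505 : ℝ) / 1977 ∧ c * (2 * c - 1)⁻¹ ≤ (1241 : ℝ) / 1977 ∧
    (6667 : ℝ) / 2256 ≤ (240 : ℝ) / 32 * ((4 - c) * (2 * c - 1)⁻¹) ∧ (2161 : ℝ) / 2820 ≤ 3 * (2 * c - 1)⁻¹ ∧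
    ((EBL : ℚ) : ℝ) ≤ 3 * (2 * c - 1)⁻¹ ∧ 3 * (2 * c - 1)⁻¹ ≤ ((EBU : ℚ) : ℝ) ∧
    (207 : ℝ) / 8644 ≤ 3 * (2 * c - 1)⁻¹ / 32 ∧ 3 * (2 * c - 1)⁻¹ / 32 ≤ (178 : ℝ) / 7433 ∧
    c⁻¹ ≤ (1609 : ℝ) / 3954 := by
  intro c
  obtain ⟨h1, h2⟩ := sqrt_11_3_bounds13
  have hc : c = (3 + Real.sqrt (11 / 3)) / 2 := rfl
  have hd : (2 * c - 1)⁻¹ = 1 / (2 + Real.sqrt (11 / 3)) := by rw [hc, inv_eq_one_div]; congr 1; ring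
  have hs0 : 0 < 2 + Real.sqrt (11 / 3) := by positivity
  have hcpos : 0 < c := by rw [hc]; positivity
  have e1 : ((EBL : ℚ) : ℝ) = 766312060385 / 10 ^ 12 := by norm_num [EBL]
  have e2 : ((EBU : ℚ) : ℝ) = 766312060386 / 10 ^ 12 := by norm_num [EBU]
  rw [hd]
  refine ⟨?_, ?_, ?_, ?_, ?_, ?_, ?_, ?_, ?_⟩
  · rw [div_le_div_iff₀ hs0 (by norm_num)]; linarith
  · rw [hc, ← mul_div_assoc, mul_one, div_le_div_iff₀ hs0 (by norm_num)]; nlinarith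
  · rw [hc, ← mul_div_assoc, mul_one, ← mul_div_assoc, div_le_div_iff₀ (by norm_num) hs0]; nlinarith
  · rw [← mul_div_assoc, mul_one, div_le_div_iff₀ (by norm_num) hs0]; nlinarith
  · rw [e1, ← mul_div_assoc, mul_one, div_le_div_iff₀ (by norm_num) hs0]; nlinarith
  · rw [e2, ← mul_div_assoc, mul_one, div_le_div_iff₀ hs0 (by norm_num)]; nlinarith
  · rw [← mul_div_assoc, mul_one, div_div, div_le_div_iff₀ (by norm_num) (by positivity)]; nlinarith
  · rw [← mul_div_assoc, mul_one, div_div, div_le_div_iff₀ (by positivity) (by norm_num)]; nlinarith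
  · rw [hc, inv_le_comm₀ hcpos (by norm_num)]; linarith

/-- `e_B ∈ [EBL, EBU]` and `ζ = 2^{e_B/32} ∈ [ZL, ZU]` (for the STAR-B tangents on the grid). -/
theorem zeta_bounds :
    ((ZL : ℚ) : ℝ) ≤ (2 : ℝ) ^ (3 * (2 * ((3 + Real.sqrt (11 / 3)) / 2) - 1)⁻¹ / 32) ∧
    (2 : ℝ) ^ (3 * (2 * ((3 + Real.sqrt (11 / 3)) / 2) - 1)⁻¹ / 32) ≤ ((ZU : ℚ) : ℝ) := by
  obtain ⟨-, -, -, -, -, -, h7, h8, -⟩ := cb_brackets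
  have e : ((2 : ℚ) : ℝ) = 2 := by norm_num
  constructor
  · have h := RpowCert.rpow_ge_cert (t := 2) (R := ZL) (α := 3 * (2 * ((3 + Real.sqrt (11 / 3)) / 2) - 1)⁻¹ / 32)
      (a := 207) (b := 8644) (by norm_num) (by norm_num) (Or.inr ⟨by norm_num, by push_cast; linarith⟩) (by decide +kernel)
    rwa [e] at h
  · have h := RpowCert.rpow_le_cert (t := 2) (R := ZU) (α := 3 * (2 * ((3 + Real.sqrt (11 / 3)) / 2) - 1)⁻¹ / 32)
      (a := 178) (b := 7433) (by norm_num) (by decide +kernel) (by norm_num) (Or.inr ⟨by norm_num, by push_cast; linarith⟩)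
      (by decide +kernel)
    rwa [e] at h

/-- The six certified factors of the STAR-B constants (`rpow_le_cert` with continued-fraction exponent brackets):
`2^{t·c₄β}` (`t = 1, 2`), `(2+h)^β` (`h = 1/2, 1`), `2^{-(240/32)(4−c₄)β}`, `(1/3)^{3β}`. -/
theorem cb_factors :
    (2 : ℝ) ^ (((1 : ℕ) : ℝ) * (((3 + Real.sqrt (11 / 3)) / 2) * (2 * ((3 + Real.sqrt (11 / 3)) / 2) - 1)⁻¹)) ≤ ((386279967347 / 250000000000 : ℚ) : ℝ) ∧
    (2 : ℝ) ^ (((2 : ℕ) : ℝ) * (((3 + Real.sqrt (11 / 3)) / 2) * (2 * ((3 + Real.sqrt (11 / 3)) / 2) - 1)⁻¹)) ≤ ((1193697705387 / 500000000000 : ℚ) : ℝ) ∧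
    (2 + (((1 / 2 : ℚ)) : ℝ)) ^ (2 * ((3 + Real.sqrt (11 / 3)) / 2) - 1)⁻¹ ≤ ((631857024321 / 500000000000 : ℚ) : ℝ) ∧
    (2 + (((1 : ℚ)) : ℝ)) ^ (2 * ((3 + Real.sqrt (11 / 3)) / 2) - 1)⁻¹ ≤ ((661979712463 / 500000000000 : ℚ) : ℝ) ∧
    (2 : ℝ) ^ (-(240 : ℝ) / 32 * ((4 - ((3 + Real.sqrt (11 / 3)) / 2)) * (2 * ((3 + Real.sqrt (11 / 3)) / 2) - 1)⁻¹)) ≤ ((128939795319 / 1000000000000 : ℚ) : ℝ) ∧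
    ((1 : ℝ) / 3) ^ (3 * (2 * ((3 + Real.sqrt (11 / 3)) / 2) - 1)⁻¹) ≤ ((10772493449 / 25000000000 : ℚ) : ℝ) := by
  obtain ⟨b1, b2, b3, b4, -, -, -, -, -⟩ := cb_brackets
  have e2 : ((2 : ℚ) : ℝ) = 2 := by norm_num
  have e52 : (((2 + 1 / 2 : ℚ)) : ℝ) = 2 + (((1 / 2 : ℚ)) : ℝ) := by push_cast; ring
  have e3 : (((2 + 1 : ℚ)) : ℝ) = 2 + (((1 : ℚ)) : ℝ) := by push_cast; ring
  have e13 : (((1 / 3 : ℚ)) : ℝ) = 1 / 3 := by norm_num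
  refine ⟨?_, ?_, ?_, ?_, ?_, ?_⟩
  · have hh := RpowCert.rpow_le_cert (t := 2) (R := 386279967347 / 250000000000) (α := ((1 : ℕ) : ℝ) * (((3 + Real.sqrt (11 / 3)) / 2) * (2 * ((3 + Real.sqrt (11 / 3)) / 2) - 1)⁻¹)) (a := 1241)
      (b := 1977) (by norm_num) (by norm_num) (by norm_num) (Or.inr ⟨by norm_num, by push_cast; linarith⟩) (by decide +kernel)
    rwa [e2] at hh
  · have hh := RpowCert.rpow_le_cert (t := 2) (R := 1193697705387 / 500000000000) (α := ((2 : ℕ) : ℝ) * (((3 + Real.sqrt (11 / 3)) / 2) * (2 * ((3 + Real.sqrt (11 / 3)) / 2) - 1)⁻¹)) (a := 2482)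
      (b := 1977) (by norm_num) (by norm_num) (by norm_num) (Or.inr ⟨by norm_num, by push_cast; linarith⟩) (by decide +kernel)
    rwa [e2] at hh
  · have hh := RpowCert.rpow_le_cert (t := 2 + 1 / 2) (R := 631857024321 / 500000000000) (α := (2 * ((3 + Real.sqrt (11 / 3)) / 2) - 1)⁻¹) (a := 505) (b := 1977)
      (by norm_num) (by norm_num) (by norm_num) (Or.inr ⟨by norm_num, by push_cast; linarith⟩) (by decide +kernel)
    rwa [e52] at hh
  · have hh := RpowCert.rpow_le_cert (t := 2 + 1) (R := 661979712463 / 500000000000) (α := (2 * ((3 + Real.sqrt (11 / 3)) / 2) - 1)⁻¹) (a := 505) (b := 1977)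
      (by norm_num) (by norm_num) (by norm_num) (Or.inr ⟨by norm_num, by push_cast; linarith⟩) (by decide +kernel)
    rwa [e3] at hh
  · have hh := RpowCert.rpow_le_cert (t := 2) (R := 128939795319 / 1000000000000) (α := -(240 : ℝ) / 32 * ((4 - ((3 + Real.sqrt (11 / 3)) / 2)) * (2 * ((3 + Real.sqrt (11 / 3)) / 2) - 1)⁻¹))
      (a := -6667) (b := 2256) (by norm_num) (by norm_num) (by norm_num) (Or.inr ⟨by norm_num, by push_cast; linarith⟩)
      (by decide +kernel)
    rwa [e2] at hh
  · have hh := RpowCert.rpow_le_cert (t := 1 / 3) (R := 10772493449 / 25000000000) (α := 3 * (2 * ((3 + Real.sqrt (11 / 3)) / 2) - 1)⁻¹) (a := 2161) (b := 2820)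
      (by norm_num) (by norm_num) (by norm_num) (Or.inl ⟨by norm_num, by push_cast; linarith⟩) (by decide +kernel)
    rwa [e13] at hh

/-- **Certification of the STAR-B table**: `C_B(h,t) ≤ CBU240 h t` for every entry. -/
theorem CB_le_CBU240 {h : ℚ} {t : ℕ} {cb : ℚ} (hcb : CBU240 h t = some cb) :
    (((((1 : ℝ) / 2) ^ t) ^ ((3 + Real.sqrt (11 / 3)) / 2))⁻¹ * (2 + (h : ℝ)) * Mtop 240 ^ (4 - (3 + Real.sqrt (11 / 3)) / 2)) ^
        (2 * ((3 + Real.sqrt (11 / 3)) / 2) - 1)⁻¹ * ((1 : ℝ) / 3) ^ (3 * (2 * ((3 + Real.sqrt (11 / 3)) / 2) - 1)⁻¹) ≤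
      ((cb : ℚ) : ℝ) := by
  set c := (3 + Real.sqrt (11 / 3)) / 2 with hc
  obtain ⟨f1, f2, f3, f4, f5, f6⟩ := cb_factors
  rw [← hc] at f1 f2 f3 f4 f5 f6
  have hc2 : 2 < c := ConvexBootstrap.two_lt_c4
  have hdpos : 0 < 2 * c - 1 := by linarith
  set β := (2 * c - 1)⁻¹ with hβ
  have hβ0 : 0 ≤ β := (inv_pos.mpr hdpos).le
  have hθ : (0 : ℝ) < ((1 : ℝ) / 2) ^ t := by positivity
  have hθc : 0 < (((1 : ℝ) / 2) ^ t) ^ c := Real.rpow_pos_of_pos hθ _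
  have hM : 0 ≤ Mtop 240 ^ (4 - c) := Real.rpow_nonneg (Mtop_pos 240).le _
  -- the four cases of the table
  have cases : (h = 1 / 2 ∨ h = 1) ∧ (t = 1 ∨ t = 2) := by
    unfold CBU240 at hcb; split_ifs at hcb <;> simp_all
  have h2h : (0 : ℝ) ≤ 2 + (h : ℝ) := by rcases cases.1 with rfl | rfl <;> norm_num
  -- factorisation of the constant
  have h20 : (0 : ℝ) ≤ 2 := by norm_num
  have e1 : (((((1 : ℝ) / 2) ^ t) ^ c)⁻¹ * (2 + (h : ℝ)) * Mtop 240 ^ (4 - c)) ^ β =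
      (2 : ℝ) ^ ((t : ℝ) * (c * β)) * (2 + (h : ℝ)) ^ β * (2 : ℝ) ^ (-(240 : ℝ) / 32 * ((4 - c) * β)) := by
    rw [Real.mul_rpow (mul_nonneg (inv_pos.mpr hθc).le h2h) hM, Real.mul_rpow (inv_pos.mpr hθc).le h2h,
      half_pow_rpow_inv t c, ← Real.rpow_mul h20]
    congr 1
    · congr 1; congr 1; ring
    · simp only [Mtop]; rw [← Real.rpow_mul h20, ← Real.rpow_mul h20]; congr 1; push_cast; ring
  rw [e1]
  have hA : 0 ≤ (2 : ℝ) ^ ((t : ℝ) * (c * β)) := by positivity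
  have hC : 0 ≤ (2 : ℝ) ^ (-(240 : ℝ) / 32 * ((4 - c) * β)) := by positivity
  have hD : 0 ≤ ((1 : ℝ) / 3) ^ (3 * β) := by positivity
  rcases cases with ⟨hh, ht⟩
  rcases hh with rfl | rfl <;> rcases ht with rfl | rfl <;>
    simp only [CBU240] at hcb <;> norm_num at hcb <;> subst hcb
  · -- h = 1/2, t = 1
    have hB : 0 ≤ (2 + (((1 / 2 : ℚ)) : ℝ)) ^ β := Real.rpow_nonneg h2h _
    have := mul_le_mul (mul_le_mul (mul_le_mul f1 f3 hB (hA.trans f1)) f5 hC (mul_nonneg (hA.trans f1) (hB.trans f3))) f6 hD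
      (mul_nonneg (mul_nonneg (hA.trans f1) (hB.trans f3)) (hC.trans f5))
    refine le_trans (le_of_eq (by push_cast; ring_nf)) (this.trans ?_)
    norm_num
  · -- h = 1/2, t = 2
    have hB : 0 ≤ (2 + (((1 / 2 : ℚ)) : ℝ)) ^ β := Real.rpow_nonneg h2h _
    have := mul_le_mul (mul_le_mul (mul_le_mul f2 f3 hB (hA.trans f2)) f5 hC (mul_nonneg (hA.trans f2) (hB.trans f3))) f6 hD
      (mul_nonneg (mul_nonneg (hA.trans f2) (hB.trans f3)) (hC.trans f5))
    refine le_trans (le_of_eq (by push_cast; ring_nf)) (this.trans ?_)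
    norm_num
  · -- h = 1, t = 1
    have hB : 0 ≤ (2 + (((1 : ℚ)) : ℝ)) ^ β := Real.rpow_nonneg h2h _
    have := mul_le_mul (mul_le_mul (mul_le_mul f1 f4 hB (hA.trans f1)) f5 hC (mul_nonneg (hA.trans f1) (hB.trans f4))) f6 hD
      (mul_nonneg (mul_nonneg (hA.trans f1) (hB.trans f4)) (hC.trans f5))
    refine le_trans (le_of_eq (by push_cast; ring_nf)) (this.trans ?_)
    norm_num
  · -- h = 1, t = 2
    have hB : 0 ≤ (2 + (((1 : ℚ)) : ℝ)) ^ β := Real.rpow_nonneg h2h _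
    have := mul_le_mul (mul_le_mul (mul_le_mul f2 f4 hB (hA.trans f2)) f5 hC (mul_nonneg (hA.trans f2) (hB.trans f4))) f6 hD
      (mul_nonneg (mul_nonneg (hA.trans f2) (hB.trans f4)) (hC.trans f5))
    refine le_trans (le_of_eq (by push_cast; ring_nf)) (this.trans ?_)
    norm_num

/-! ### The STAR rows of template S hold for the scaled law -/

/-- `Σ₃(w)` vanishes on `LARGE_w`. -/
theorem sig3_large : ∀ τ ∈ allTypes, ∀ w ∈ [1, 2, 3, 4], τ.large w = true → sig3φ w τ = 0 := by decide +kernel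

/-- Grid support power with a doubled exponent: `(2^{i/32})^{2q} = 2^{(q/32)(2i)}`; and the plain one `(2^{i/32})^{α} = 2^{(α/32)i}`. -/
theorem supp_rpow (i : ℤ) (α : ℝ) : ((2 : ℝ) ^ ((i : ℝ) / 32)) ^ α = (2 : ℝ) ^ (α / 32 * ((i : ℤ) : ℝ)) := by
  rw [← Real.rpow_mul (by norm_num)]; congr 1; ring

/-- **sqrt-STAR rows.**  A row `.star z t i N G H` accepted by `SRow.ok K cs rs` holds for the scaled law of the case. -/
theorem star_valid (L : SLaw K cs M x) {rs : Bool} {z t : ℕ} {i : ℤ} {N G : ℕ} {H : ℚ}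
    (hok : (SRow.star z t i N G H).ok K cs rs = true) :
    lin ((SRow.star z t i N G H).toRow cs).φ (xs rs K M cs.w x) ≤ (((SRow.star z t i N G H).toRow cs).b : ℝ) := by
  simp only [SRow.ok, Bool.and_eq_true, decide_eq_true_eq, Bool.not_eq_true'] at hok
  obtain ⟨⟨⟨⟨⟨⟨⟨⟨hrs, hz⟩, hzw⟩, _⟩, hK⟩, ht⟩, hN⟩, c1⟩, c2⟩ := hok
  have hzw' : z ≠ cs.w := by simpa using hzw
  cases rs
  swap
  · simp at hrs
  obtain ⟨hc, hql, hqu, hq2, -⟩ := c4_facts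
  have hroot := sqrt_star_root L hK hz hzw' ht
  obtain ⟨-, hLpos⟩ := L.scal_pos
  have hS0 : 0 ≤ lin sig4φ (xs false K M cs.w x) := by
    rw [lin_xs]; exact mul_nonneg hLpos.le (sig_nonneg L.nonneg L.wmem).1
  have hP : ((2 : ℝ) ^ ((i : ℝ) / 32)) ^ (2 * ((3 + Real.sqrt (11 / 3)) / 2)⁻¹) ≤ ((powUp TH4L TH4U (2 * i) : ℚ) : ℝ) := by
    rw [supp_rpow]
    have h := grid_le (by decide +kernel) theta4_bounds.1 theta4_bounds.2 (2 * i)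
    refine le_trans (le_of_eq ?_) h
    congr 1; push_cast; ring
  have hql' : (((2 * QL4 : ℚ)) : ℝ) ≤ 2 * ((3 + Real.sqrt (11 / 3)) / 2)⁻¹ := by push_cast; linarith
  have hqu' : 2 * ((3 + Real.sqrt (11 / 3)) / 2)⁻¹ ≤ (((2 * QU4 : ℚ)) : ℝ) := by push_cast; linarith
  have h := cut1_sound hroot hS0 (by positivity) hq2 (by exact_mod_cast (CuS_pos K t).le) le_rfl hP hql' hqu' hN c1 c2
  simp only [SRow.toRow, lin_combo, List.map_cons, List.map_nil, List.sum_cons, List.sum_nil, Tm] at h ⊢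
  push_cast at h ⊢
  linarith

/-- **STAR-B rows.**  A row `.starB z t i N G H` accepted by `SRow.ok K cs rs` holds for the (restricted) scaled law of the case. -/
theorem starB_valid (L : SLaw K cs M x) {rs : Bool} {z t : ℕ} {i : ℤ} {N G : ℕ} {H : ℚ}
    (hok : (SRow.starB z t i N G H).ok K cs rs = true) :
    lin ((SRow.starB z t i N G H).toRow cs).φ (xs rs K M cs.w x) ≤ (((SRow.starB z t i N G H).toRow cs).b : ℝ) := by
  simp only [SRow.ok, Bool.and_eq_true, decide_eq_true_eq, Bool.not_eq_true', Bool.or_eq_true] at hok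
  obtain ⟨⟨⟨⟨⟨⟨hz, hzw⟩, hw⟩, hK⟩, ht⟩, hN⟩, hc⟩ := hok
  have hzw' : z ≠ cs.w := by simpa using hzw
  subst hK
  -- unpack the table lookups
  cases hb : (cs.bandOf cs.w).hi with
  | none => simp [hb] at hc
  | some h =>
    simp only [hb] at hc
    cases hcb : CBU240 h t with
    | none => simp [hcb] at hc
    | some cb =>
      simp only [hcb, Bool.and_eq_true, decide_eq_true_eq] at hc
      obtain ⟨c1, c2⟩ := hc
      obtain ⟨-, -, -, -, bEL, bEU, -, -, -⟩ := cb_brackets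
      set β := (2 * ((3 + Real.sqrt (11 / 3)) / 2) - 1)⁻¹ with hβ
      have hd : 0 < 2 * ((3 + Real.sqrt (11 / 3)) / 2) - 1 := by linarith [ConvexBootstrap.two_lt_c4]
      have hβ0 : 0 ≤ 3 * β := mul_nonneg (by norm_num) (inv_pos.mpr hd).le
      have hβ1 : 3 * β ≤ 1 := by
        have e : ((EBU : ℚ) : ℝ) = 766312060386 / 10 ^ 12 := by norm_num [EBU]
        linarith [bEU, e.le, e.ge]
      -- the unrestricted row
      have h0 : lin ((SRow.starB z t i N G H).toRow cs).φ (xs false 240 M cs.w x) ≤ (H : ℝ) := by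
        have hroot := starB_root L hz hzw' hb ht
        have hCB := CB_le_CBU240 hcb
        obtain ⟨-, hLpos⟩ := L.scal_pos
        have hS0 : 0 ≤ lin (sig3φ cs.w) (xs false 240 M cs.w x) := by
          rw [lin_xs]; exact mul_nonneg hLpos.le (sig_nonneg L.nonneg L.wmem).2
        have hC0 : 0 ≤ (((((1 : ℝ) / 2) ^ t) ^ ((3 + Real.sqrt (11 / 3)) / 2))⁻¹ * (2 + (h : ℝ)) *
            Mtop 240 ^ (4 - (3 + Real.sqrt (11 / 3)) / 2)) ^ (2 * ((3 + Real.sqrt (11 / 3)) / 2) - 1)⁻¹ *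
            ((1 : ℝ) / 3) ^ (3 * (2 * ((3 + Real.sqrt (11 / 3)) / 2) - 1)⁻¹) := by
          have h2h : (0 : ℝ) ≤ 2 + (h : ℝ) := by
            have hbh := L.bandHi cs.w L.wmem h hb
            have hS' : 0 ≤ Sm cs.w x := lin_ind_nonneg _ L.nonneg
            have hTw := L.Tpos cs.w L.wmem
            nlinarith
          have hθc : 0 < (((1 : ℝ) / 2) ^ t) ^ ((3 + Real.sqrt (11 / 3)) / 2) := Real.rpow_pos_of_pos (by positivity) _
          have hM : 0 ≤ Mtop 240 ^ (4 - (3 + Real.sqrt (11 / 3)) / 2) := Real.rpow_nonneg (Mtop_pos 240).le _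
          positivity
        have hP : ((2 : ℝ) ^ ((i : ℝ) / 32)) ^ (3 * β) ≤ ((powUp ZL ZU i : ℚ) : ℝ) := by
          rw [supp_rpow]
          exact grid_le (by decide +kernel) zeta_bounds.1 zeta_bounds.2 i
        have hcut := cut1_sound hroot hS0 hβ0 hβ1 hC0 hCB hP bEL bEU hN c1 c2
        simp only [SRow.toRow, lin_combo, List.map_cons, List.map_nil, List.sum_cons, List.sum_nil, Tm] at hcut ⊢
        push_cast at hcut ⊢
        linarith
      cases rs
      · exact h0
      · -- restriction: the functional is `≥ 0` on `LARGE_w` (Σ₃(w) vanishes there)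
        have e : xs true 240 M cs.w x = fun τ => if τ.large cs.w then 0 else (xs false 240 M cs.w x) τ := by
          funext τ; simp [xs]
        rw [e]
        obtain ⟨-, hLpos⟩ := L.scal_pos
        refine le_trans (lin_restrict_le (fun τ hτ hl => ?_) (fun τ => ?_)) h0
        · simp only [SRow.toRow, combo, List.map_cons, List.map_nil, List.sum_cons, List.sum_nil, add_zero,
            sig3_large τ hτ cs.w hw hl, mul_zero]
          have : (0 : ℤ) ≤ ind (τ.isT z) := by unfold ind; split <;> norm_num
          positivity
        · rw [xs_false]; exact mul_nonneg hLpos.le (L.nonneg τ)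

end

end TypeTable
end HubOnly

end Summit.CriticalPhenomena.PercolationContinuityZ3.Theorems
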